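import Summits.Schanuel.Schanuel.Theses.RigidCore
import Literature.NumberTheory.Transcendental.GammaFields
import HarnessLib.Audit

/-!
# Line `span-growth-dichotomy` — skeleton for crux `RigidCore.MinimalCounterexampleInAcl`
(item stmt-Schanuel-0969, route route-Schanuel-RigidCore; idea card
`Cruxes/MinimalCounterexampleInAcl/Ideas/span-growth-dichotomy.md`, ideator 1, round 1;
triage TRIAGE-r1-1/2/3: pass ×3 "with doubt": the lever is true, the closing is CONDITIONAL)

Crux (S*): a first-failure counterexample `x ∈ ℂⁿ` to Schanuel (`x` ℚ-linearly independent,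
`trdeg ℚ(x, eˣ) < n`, `SchanuelRank r` for all `r < n`) has every coordinate in `acl^{ℂ_exp}(∅)`
(a FINITE `∅`-definable subset of `(ℂ, +, ·, −, 0, 1, exp)` through `x i`).

Idea (ONE lever): the ℚ-SPAN FILTRATION of the family of *locus mates* of `x` (the ℚ-linearly
independent tuples `x'` satisfying every ℚ-polynomial relation of `(x, eˣ)`, i.e. the independent
graph points of the ℚ-locus `W_x`) and Hrushovski SUBMODULARITY of the predimension
`δ(S) = td(ℚ(S, e^S)/ℚ) − dim_ℚ S` (tree: `GammaField.predim ⊥ S`, Bays–Kirby 2018 Def. 4.1 /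
Lemma 4.2, PROVED `GammaField.predim_sup_le`, `predim_add`). Every mate has `δ(span x') ≤ −1`
(`stub_matePredim`: a mate is a point of the same `W_x`, `dim W_x < n`), and a mate that is NOT in a
finitely generated ℚ-space `S` costs one more unit of predimension: `δ(S + span x') ≤ δ(S) − 1`
(`stub_spanGrowthStep`: submodularity, with `δ(S ∩ span x') ≥ 0` paid by the crux's own
hypothesis `SC(<n)` on the PROPER subspace `S ∩ span x' ⊊ span x'`). Hence the DICHOTOMY
(`span_growth_dichotomy`, sorry-free glue over the two stubs): along the mate family of one
first-failure locus EITHER the predimension is unbounded below ("Schanuel fails infinitely badly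
inside one ℚ-locus": towers `span(x ∪ G_k)` with `δ ≤ −(k+1)` for every `k`) OR all mates lie in ONE
finite-dimensional ℚ-space. The first branch is excluded by the residual stub
`stub_locusDefectBounded` (OPEN; the local face of Bays–Kirby's bounded defect, kernel-checked
here: `locusDefectBounded_of_boundedDefectδ`), the second is the finite-rank unlikely-intersection
statement `stub_finiteRankCase` (mates confined to `span s` are finitely many: the exponentials live
in the finite-rank division group of `⟨e^{s_j}⟩`, Laurent/McQuillan Mordell–Lang in `𝔾_mⁿ` + growth
+ isolation — the HARDEST stub, attackable now), and finiteness of the mate set gives the crux by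
`stub_isolationFree` ("definable isolation is free": `ℤ` is `∅`-definable in `ℂ_exp`,
`kmo_definable_isInt`, so `locusMates x` is ONE `∅`-formula; a finite `∅`-definable set of tuples has
finite `∅`-definable coordinate projections). `MinimalCounterexampleInAcl_of` concludes the crux BY
NAME over the five stubs; everything under `## Glue` is sorry-free.

Status of the line: CONDITIONAL — it closes (S*) relative to `stub_locusDefectBounded`
(strictly weaker than the card's global `BoundedDefect`, itself the `∃ d` weakening of Schanuel and
the cheapest consequence of "`ℂ_exp ≅` some Bays–Kirby `𝕄(F_base)`", arXiv:1512.04262 §9.2) and to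
`stub_finiteRankCase`. Stubs T1/T2/I are theorems waiting to be written (sizes M); given them,
`stub_locusDefectBounded` is EQUIVALENT to bounded ℚ-rank of the mate family (glue
`mates_rank_bounded` one way, `td ≥ 0` the other), so the line prices (S*) at exactly
"bounded rank along one locus + finite-rank sparsity".

Disproof obligations honoured (cdisprove gen2 v11 for stmt-Schanuel-0969; the file itself is not
mounted in this jail nor published under `Cruxes/…/Disproof.lean` — its eleven evidence notes were
used, as by all three triagers): `not_withoutTrdeg` — the bound `trdeg < n` is consumed in
`stub_matePredim` (`δ(span x) ≤ −1`); `not_withoutLinIndep_of_schanuelRank_two` — linear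
independence is part of `locusMates`/`IsFirstFailure` and is consumed in `stub_spanGrowthStep`
(`dim span x' = n`, so `S ∩ span x'` is a PROPER subspace of dimension `< n`); `withoutFirstFailure_
defectLeOne` — the first-failure hypothesis `∀ r < n, SchanuelRank r` is consumed in
`stub_spanGrowthStep` (`δ ≥ 0` on subspaces of dimension `< n`) and nowhere else;
`uniformVersion_iff_schanuel` — respected: `d` in `stub_locusDefectBounded` and `s` in the glue depend
on `x` (no uniformity over first failures is claimed); `countableVersion_holds` / `firstFailure_mem_ecl`
— consistent: finiteness (not countability) is produced, by `stub_finiteRankCase`; `firstFailure_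
trdeg_eq` / `rankTwo_trdeg_eq_one` — only the inequality `δ ≤ −1` is used; `CruxRankTwo` — at `n = 2`
the hypothesis `hrank` of `stub_spanGrowthStep` is a theorem (`schanuelRank_zero/one`; tree
`Summit.…Theorems.RoyCriterionRankOne`). No landed `Theorems/MinimalCounterexampleInAcl/Negative/`
lemma exists; `ledger negatives --problem Schanuel` = 2 PolarPhantoms items, unrelated; no stub is
an instance of either.

`lean check`: sorries ONLY in `stub_matePredim`, `stub_spanGrowthStep`, `stub_locusDefectBounded`,
`stub_finiteRankCase`, `stub_isolationFree`.

Gen-2 pass (planner-cruxplan-…-span-growth-dichotom-g2-0, 2026-08-16; declarations UNCHANGED — only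
docstrings refreshed, so the registered stub signatures are identical): gates re-run (rc 0; 5 sorries,
all in `stub_*`; axioms of `MinimalCounterexampleInAcl_of` = propext / sorryAx / Classical.choice /
Quot.sound; `#h21_check_skeleton` OK, theorem `MinimalCounterexampleInAcl_of`, closed = false); T1/T2
re-derived true on paper from `predim_add` / `predim_sup_le` / `SchanuelRank`; NEW tree material since
the card: the sibling crux's landed kit `Summit.Schanuel.Schanuel.Theorems.AclSubsetLogFreeCore.Negative.*`
(sorry-free, importable) — `expAcl` is VERBATIM the conclusion shape of (S*) and of Stub I,
`definableFun_mvPolynomial_aeval'` (integer polynomial maps are `∅`-definable), `definable_mem_intSet` /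
`definable₁_int` (`ℤ`), `definableFun_cexp/add'/mul'/neg'`, `AclIdempotent.modelAcl_modelAcl`,
`expAcl_relAlgClosed` — which makes Stub I an S/M assembly, and Mathlib's
`Algebra.trdeg_le_of_surjective` makes Stub T1 S/M (see the two docstrings). Still no
`Theorems/MinimalCounterexampleInAcl/Negative/` lemma and no published `Cruxes/…/Disproof.lean` for THIS
crux (evidence path not mounted); negatives index unchanged (2 PolarPhantoms items).
-/

noncomputable section

set_option linter.dupNamespace false

open Complex Set
open FirstOrder
open Literature.NumberTheory.Transcendental
open Literature.ModelTheory.ExponentialFields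

namespace Summit.Schanuel.Schanuel.Cruxes.MinimalCounterexampleInAcl.SpanGrowthDichotomy

/-! ## Vocabulary (verbatim copies of `Cruxes/MinimalCounterexampleInAcl/SketchIdeator1.lean`,
namespace `…Cruxes.MinimalCounterexampleInAcl.Sketch`, so that sibling lines agree by `Iff.rfl`) -/

/-- The ℚ-locus mates of `x`: tuples `x'` that are ℚ-linearly independent and satisfy every
ℚ-polynomial relation of `(x, eˣ)` — the ℚ-linearly independent graph points of the ℚ-locus `W_x`
of `(x, eˣ)` (written without naming `W_x`). Verbatim `Sketch.locusMates`. -/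
def locusMates {n : ℕ} (x : Fin n → ℂ) : Set (Fin n → ℂ) :=
  {x' | LinearIndependent ℚ x' ∧
    ∀ p : MvPolynomial (Fin n ⊕ Fin n) ℚ,
      MvPolynomial.aeval (Sum.elim x (cexp ∘ x)) p = 0 →
      MvPolynomial.aeval (Sum.elim x' (cexp ∘ x')) p = 0}

/-- First-failure counterexample at rank `n` — the crux's hypothesis bundle, verbatim
`Sketch.IsFirstFailure`. -/
def IsFirstFailure {n : ℕ} (x : Fin n → ℂ) : Prop :=
  LinearIndependent ℚ x ∧
  Algebra.trdeg ℚ ↥(IntermediateField.adjoin ℚ (range x ∪ range (cexp ∘ x))) < (n : Cardinal) ∧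
  ∀ r < n, SchanuelRank r

/-- The coordinates of all locus mates of `x` (a subset of `ℂ`; the "mate span" is its ℚ-span). -/
def mateCoords {n : ℕ} (x : Fin n → ℂ) : Set ℂ :=
  ⋃ x' ∈ locusMates x, range x'

/-- `DeepTower x k`: finitely many mate coordinates `G` already push the predimension of
`span(x ∪ G)` down to `≤ −(k+1)` ("a span-growth tower of depth `k` over `x`"). -/
def DeepTower {n : ℕ} (x : Fin n → ℂ) (k : ℕ) : Prop :=
  ∃ G : Finset ℂ, (G : Set ℂ) ⊆ mateCoords x ∧
    GammaField.predim (⊥ : Submodule ℚ ℂ) (Submodule.span ℚ (range x ∪ (G : Set ℂ))) ≤ -((k : ℤ) + 1)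

/-- **Bounded Schanuel defect** ("`ℂ_exp` is Bays–Kirby-like", card K2, CONDITIONAL INPUT — never a
stub): the predimension of finitely generated ℚ-subspaces of `ℂ` is bounded below. This is the
card's `Sketch.BoundedDefect` (`∃ d, ∀ m z, LinearIndependent ℚ z → m ≤ trdeg ℚ(z, e^z) + d`)
transported to `GammaField.predim ⊥` along the PROVED bridge
`GammaField.toENat_trdeg_adjoin_eq_relRank` (GammaFieldsEcl.lean); `d = 0` is Schanuel's conjecture,
so it is implied by `Schanuel` and irrefutable short of `¬ Schanuel`; as a theorem it is beyond the
barrier `Literature.Barriers.Schanuel.LargeTranscendenceDegree` (it contains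
`trdeg(log p₁, …, log p_N) ≥ N − d`). Used below ONLY in `locusDefectBounded_of_boundedDefectδ`. -/
def BoundedDefectδ : Prop :=
  ∃ d : ℕ, ∀ S : Submodule ℚ ℂ, S.FG → -(d : ℤ) ≤ GammaField.predim (⊥ : Submodule ℚ ℂ) S

/-! ## Stubs (the registered open lemmas of the line)

Each stub is stated as ONE closed `Prop` after the colon with the vocabulary INLINED over Mathlib + tree
declarations (fully qualified: `IsFirstFailure x` ↦ its three conjuncts, `x' ∈ locusMates x` ↦ its two conjuncts,
`mateCoords x` ↦ the `⋃`), so that the registered signature can be restated verbatim in a sorry-free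
`Theorems/RigidCoreMinimalCounterexampleInAcl<StubName>.lean` (`--supports stmt-Schanuel-0969`) WITHOUT importing this
workfile; the readable forms `matePredim`, `spanGrowthStep`, `locusDefectBounded`, `finiteRankCase`, `isolationFree`
under `## Glue` are definitional restatements (they type-check the agreement) and are what the composition uses.
Imports that suffice for every signature: `Summits.Schanuel.Schanuel.Theses.RigidCore` (Mathlib, `SchanuelRank`,
`Language.expRing`) + `Literature.NumberTheory.Transcendental.GammaFields` (`GammaField.predim`). -/

/-- **Stub T1 — mates have predimension `≤ −1` (provable now, size M).** For a first-failure `x`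
(hypothesis 1: `x` ℚ-linearly independent, `trdeg ℚ(x, eˣ) < n`, Schanuel in all ranks `< n`) and any locus
mate `x'` of `x` (hypothesis 2: `x'` ℚ-linearly independent and `(x', e^{x'})` satisfies every ℚ-polynomial
relation of `(x, eˣ)`; `x' = x` is allowed), `δ(span_ℚ x') = td(ℚ(x', e^{x'})) − n ≤ −1`.
Why true: `x'` is ℚ-linearly independent, so `dim span x' = n` (`GammaField.ldim ⊥`); the relation
ideal of `(x', e^{x'})` CONTAINS that of `(x, eˣ)`, so `ℚ[x', e^{x'}]` is a quotient of `ℚ[x, eˣ]` and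
`trdeg ℚ(x', e^{x'}) ≤ trdeg ℚ(x, eˣ) ≤ n − 1` (hypothesis `trdeg < n`; Disproof `firstFailure_trdeg_eq`
even gives `= n − 1` for `x`); finally `td ⊥ (span x') = toENat (trdeg ℚ (adjoin ℚ (range x' ∪ exp '' range x')))`
by the bridge `GammaField.toENat_trdeg_adjoin_eq_relRank` + `Matroid.relRank_congr_closure`
(`GammaField.gens_sup_span_subset_acl`). Honours `not_withoutTrdeg` (this is where `trdeg < n` is spent).
Lean plan: algebra-hom `Algebra.adjoin ℚ (gens x) →ₐ Algebra.adjoin ℚ (gens x')` from the ideal containment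
(`MvPolynomial.aeval` factorisation), transcendence degree does not increase under surjections (lift an
algebraically independent family), fraction-field invariance of `trdeg`. Readable form: `matePredim`.
Gen-2 pointers (size S/M, ~150–250 lines): the surjection step is Mathlib's
`Algebra.trdeg_le_of_surjective (f : A →ₐ[R] A') (hf : Surjective f) : trdeg R A' ≤ trdeg R A` applied to
`(MvPolynomial.aeval (Sum.elim x' (cexp ∘ x'))).rangeRestrict`-type maps factored through
`Algebra.adjoin ℚ (range (Sum.elim x (cexp ∘ x)))` (kernel containment = hypothesis 2, `Ideal.Quotient.lift` /
`AlgHom` on `adjoin = aeval range`: `Algebra.adjoin_range_eq_range_aeval`); `Algebra.adjoin` vs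
`IntermediateField.adjoin`: the field is algebraic over the subalgebra (`IntermediateField.adjoin_eq_…` /
tree `isAlgebraic_adjoin_over_algebraAdjoin` as used in `SchanuelEclEmptyProofs.trdeg_adjoin_le_of_le`), so the
`trdeg`s agree; the `td`/`trdeg` bridge is `GammaField.toENat_trdeg_adjoin_eq_relRank (⊥ : IntermediateField ℚ ℂ)`
+ `Matroid.relRank_congr_closure_left` (closure of `gens ⊥ = {0, 1}` = closure of `∅`) + `Matroid.relRank_congr_closure`
(both tree lemmas, `Literature/Combinatorics/Matroid/RelRank.lean`) for
`acl (gens (span (range x'))) = acl (range x' ∪ cexp '' range x')` (`GammaField.gens_sup_span_subset_acl ⊥`);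
`ldim ⊥ (span (range x')) = n` from `LinearIndependent ℚ x'` (`finrank_span_eq_card`, `Submodule.mkQ` of `⊥` is
injective). The same inequality `trdeg(x') ≤ trdeg(x)` is Stub `MateFirstFailure` of the sibling line
kernel-arithmetic-selection — one proof serves both. -/
theorem stub_matePredim :
    ∀ {n : ℕ} {x : Fin n → ℂ},
      (LinearIndependent ℚ x ∧
        Algebra.trdeg ℚ ↥(IntermediateField.adjoin ℚ (Set.range x ∪ Set.range (Complex.exp ∘ x))) <
          (n : Cardinal) ∧
        ∀ r < n, Literature.NumberTheory.Transcendental.SchanuelRank r) →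
      ∀ {x' : Fin n → ℂ},
        (LinearIndependent ℚ x' ∧
          ∀ p : MvPolynomial (Fin n ⊕ Fin n) ℚ,
            MvPolynomial.aeval (Sum.elim x (Complex.exp ∘ x)) p = 0 →
              MvPolynomial.aeval (Sum.elim x' (Complex.exp ∘ x')) p = 0) →
        Literature.NumberTheory.Transcendental.GammaField.predim (⊥ : Submodule ℚ ℂ)
          (Submodule.span ℚ (Set.range x')) ≤ -1 := by
  sorry

/-- **Stub T2 — the span-growth step (provable now, size M; the card's lever `span_growth_pair`, one mate
at a time and against an ARBITRARY finitely generated ℚ-space `S`).** If Schanuel holds in all ranks `< n`,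
`x' ∈ ℂⁿ` is ℚ-linearly independent with `δ(span x') ≤ −1`, and `x'` is not inside `S`, then
`δ(S + span x') ≤ δ(S) − 1`.
Why true (Bays–Kirby 2018 Lemma 4.2, tree PROVED): with `U' = span x'`,
`δ(S ⊔ U') − δ(S) = predim S (U' ⊔ S) ≤ predim (U' ⊓ S) U' = δ(U') − δ(U' ⊓ S)`
(`GammaField.predim_add` twice + `GammaField.predim_sup_le U' S`, finiteness `GammaField.IsFG` from `S.FG`
and `dim U' = n`); `δ(U') ≤ −1` by hypothesis; and `U' ⊓ S ⊊ U'` (as `range x' ⊄ S`) has dimension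
`r < n`, so a basis `v : Fin r → ℂ` of it is ℚ-linearly independent and `SchanuelRank r` gives
`td ⊥ (U' ⊓ S) ≥ trdeg ℚ(v, e^v) ≥ r = ldim ⊥ (U' ⊓ S)`, i.e. `δ(U' ⊓ S) ≥ 0` (bridge
`toENat_trdeg_adjoin_eq_relRank`, monotonicity `Matroid.relRank_mono_right`). This is the ONLY place the
first-failure hypothesis `SC(<n)` is spent (honours `withoutFirstFailure_defectLeOne`: without it a
rank-`(n−1)` counterexample inside `S ∩ span x'` keeps the joint defect at `−1`), and linear independence of
`x'` is essential (`not_withoutLinIndep_of_schanuelRank_two`): it is what makes `S ∩ span x'` a PROPER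
subspace of dimension `< n`. `n = 0` is vacuous (`range x' = ∅ ⊆ S`). At `n = 2` the hypothesis is a theorem
(Hermite–Lindemann: `schanuelRank_zero`, `Summit.…Theorems.RoyCriterionRankOne.schanuelRank_one_of_transcendental_exp`).
Readable form: `spanGrowthStep`. -/
theorem stub_spanGrowthStep :
    ∀ {n : ℕ}, (∀ r < n, Literature.NumberTheory.Transcendental.SchanuelRank r) →
      ∀ {x' : Fin n → ℂ}, LinearIndependent ℚ x' →
        Literature.NumberTheory.Transcendental.GammaField.predim (⊥ : Submodule ℚ ℂ)
            (Submodule.span ℚ (Set.range x')) ≤ -1 →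
        ∀ S : Submodule ℚ ℂ, S.FG → ¬ (Set.range x' ⊆ (S : Set ℂ)) →
          Literature.NumberTheory.Transcendental.GammaField.predim (⊥ : Submodule ℚ ℂ)
              (S ⊔ Submodule.span ℚ (Set.range x')) ≤
            Literature.NumberTheory.Transcendental.GammaField.predim (⊥ : Submodule ℚ ℂ) S - 1 := by
  sorry

/-- **Stub D — bounded defect along the mate span (OPEN; the residual, CONDITIONAL stub of the line =
negation of branch (I) of the dichotomy).** For a first-failure `x` there is `d` such that
`δ(span_ℚ(x ∪ G)) ≥ −d` for every finite set `G` of coordinates of locus mates of `x` (`G ⊆ ⋃ mates, range`):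
"Schanuel does not fail infinitely badly inside one ℚ-locus".
Why plausibly true: implied by `Schanuel` (no first failure exists: vacuous) — hence irrefutable short of
`¬ Schanuel`, like the crux; implied by the global `BoundedDefectδ` (`locusDefectBounded_of_boundedDefectδ`
below), i.e. by the weakest structural form of "`ℂ_exp ≅` a Bays–Kirby field `𝕄(F_base)`" (arXiv:1512.04262
§9.2: Schanuel fails only inside a finite-dimensional ℚ-space, with bounded defect); given T1/T2 it is
EQUIVALENT to bounded ℚ-rank of the mate family (`mates_rank_bounded`; conversely
`locusDefectBounded_of_rank_bounded`, `td ≥ 0`). Why it might fail / price: branch (I) is exactly where the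
Shapiro/Dirichlet atoms of `SparsityTwo` would live (their solution families have unbounded ℚ-rank,
TRIAGE-r1-3), so the stub RELOCATES rather than shrinks that case; as a theorem the global form is beyond
`Literature.Barriers.Schanuel.LargeTranscendenceDegree` (card K2). Do not attack head-on: the line is
conditional on it by design; instance engines = T1/T2 themselves (`N` span-new mates realise `N` algebraically
disjoint exp-compatible copies of the function field of `W_x` inside `ecl ∅`). Readable form:
`locusDefectBounded`. -/
theorem stub_locusDefectBounded :
    ∀ {n : ℕ} {x : Fin n → ℂ},
      (LinearIndependent ℚ x ∧
        Algebra.trdeg ℚ ↥(IntermediateField.adjoin ℚ (Set.range x ∪ Set.range (Complex.exp ∘ x))) <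
          (n : Cardinal) ∧
        ∀ r < n, Literature.NumberTheory.Transcendental.SchanuelRank r) →
      ∃ d : ℕ, ∀ G : Finset ℂ,
        (G : Set ℂ) ⊆ (⋃ x' ∈ {x' : Fin n → ℂ | LinearIndependent ℚ x' ∧
          ∀ p : MvPolynomial (Fin n ⊕ Fin n) ℚ,
            MvPolynomial.aeval (Sum.elim x (Complex.exp ∘ x)) p = 0 →
              MvPolynomial.aeval (Sum.elim x' (Complex.exp ∘ x')) p = 0}, Set.range x') →
        -(d : ℤ) ≤ Literature.NumberTheory.Transcendental.GammaField.predim (⊥ : Submodule ℚ ℂ)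
          (Submodule.span ℚ (Set.range x ∪ (G : Set ℂ))) := by
  sorry

/-- **Stub M — the finite-rank case (OPEN but attackable now; the HARDEST stub; card K1
`Sketch.FiniteRankCase`).** If all locus mates of a first-failure `x` lie in one finitely generated ℚ-space
`span_ℚ s`, there are only finitely many of them.
Why plausibly true / plan (card K1, TRIAGE-r1-1/2/3): a mate is `x' = B·s` with `B ∈ ℚ^{n×|s|}`, so
`e^{x'}` lies in the finite-rank DIVISION GROUP `Γ = ⟨e^{s_j}⟩_div ⁿ ≤ (ℂˣ)ⁿ` and in `Y = pr_y(W_x)`,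
`dim Y < n`: Mordell–Lang in `𝔾_mⁿ` for finite-rank groups (Laurent 1984 [bib Laurent1984]; division points
McQuillan 1995 [bib Mcquillan1995]; uniform: Evertse–Schlickewei–Schmidt 2002 [bib EvertseSchlickeweiSchmidt2002]
— named facts to vendor) puts the exponentials on finitely many torus cosets `γT ⊆ Y` (tree vocabulary
`torusLocus`, `IsTorusCoset`); characters trivial on `T` give INTEGER parameters (`⟨q, x'⟩ ∈ log χ_q(γ) + 2πiℤ`:
the sub-family `BranchFiniteness` of card sweep-below-rank, translates `x + 2πik`, is the case `2πi ∈ span s`);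
unitary `T`-directions force bounded `x'`, hence finitely many by ISOLATION (first failure + Ax–Schanuel
`ax_schanuel_holds` make every mate an isolated point of `{z | (z, e^z) ∈ W_x}`, and isolated points of a closed
analytic set are closed-discrete: shared support lemma = ends-not-points L2/L3 = kernel-arithmetic-selection (c)
= card P1 `isolated_of_firstFailure`); non-unitary directions give exponential growth of `|y|` against linear
growth of `|x'|`, so the `W_x`-relations asymptotically factor through characters (sweep-below-rank's structure
lemma on the integer exponents). Foreseen glued split (≤ 3 children): `finite rank ⇒ bounded` (Mordell–Lang +
growth) and `bounded ⇒ finite` (isolation, provable now). Why it might fail: unbounded DENOMINATORS of `B`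
(division points of growing order need Kummer/Galois growth of torsion, McQuillan-type input) and uniformity of
the growth argument over a coset `γT` (tropical/initial-form analysis of `W_x` along `γT`, unwritten). Implied
by `Schanuel` (vacuous), so irrefutable short of `¬SC(n)`; contains `BranchFiniteness` (take `2πi ∈ s`).
Readable form: `finiteRankCase`.
Gen-2 caveats for whoever builds M: (1) the additive parameter set is NOT discrete — for `|s| ≥ 3` (or `|s| = 2`
with `s₁/s₂ ∈ ℝ`) the `ℤ`-span of `s` is dense in a real subspace of `ℂ`, so "bounded `x'` ⇒ finitely many" can
NOT be read off the parameters `B`; either bound the HEIGHT and DENOMINATOR of `B ∈ ℚ^{n×|s|}` directly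
(finitely many rationals of bounded height), or use the analytic route (2); (2) "bounded ⇒ finite" via isolation
needs, besides the isolation of independent graph points (Ax–Schanuel + `SC(<n)`, ends-not-points L2), the LOCAL
FINITENESS of the family of irreducible components of a closed analytic subset of `ℂⁿ` at an accumulation point
(which may be a dependent, non-isolated point of `{z | (z, e^z) ∈ W_x}`) — standard several-complex-variables
geometry (Noetherianity of `𝒪_{ℂⁿ,z}`), absent from Mathlib: size L on its own, shared with ends-not-points L3 /
kernel-arithmetic-selection (c); at `n = 2` it is still two complex variables. The multiplicative input
(Laurent 1984 / McQuillan 1995 Mordell–Lang in `𝔾_mⁿ` for the finite-rank division group) is to be vendored as a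
NAMED FACT `def … : Prop` with a cite tag (in-flight dependency rule: written inline, relocated to
`Literature/NumberTheory/…` by the gate), never proved here. -/
theorem stub_finiteRankCase :
    ∀ {n : ℕ} {x : Fin n → ℂ},
      (LinearIndependent ℚ x ∧
        Algebra.trdeg ℚ ↥(IntermediateField.adjoin ℚ (Set.range x ∪ Set.range (Complex.exp ∘ x))) <
          (n : Cardinal) ∧
        ∀ r < n, Literature.NumberTheory.Transcendental.SchanuelRank r) →
      ∀ s : Finset ℂ,
        (∀ x' : Fin n → ℂ,
          (LinearIndependent ℚ x' ∧
          ∀ p : MvPolynomial (Fin n ⊕ Fin n) ℚ,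
            MvPolynomial.aeval (Sum.elim x (Complex.exp ∘ x)) p = 0 →
              MvPolynomial.aeval (Sum.elim x' (Complex.exp ∘ x')) p = 0) →
          Set.range x' ⊆ (Submodule.span ℚ (s : Set ℂ) : Set ℂ)) →
        Set.Finite {x' : Fin n → ℂ | LinearIndependent ℚ x' ∧
          ∀ p : MvPolynomial (Fin n ⊕ Fin n) ℚ,
            MvPolynomial.aeval (Sum.elim x (Complex.exp ∘ x)) p = 0 →
              MvPolynomial.aeval (Sum.elim x' (Complex.exp ∘ x')) p = 0} := by
  sorry

/-- **Stub I — definable isolation is free (provable now, size M; lever (a) of cards isolation-is-free ≈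
kernel-arithmetic-selection, `Sketch.crux_of_firstFailureSparsity` pointwise).** If the locus mates of a
first-failure `x` are finitely many, every coordinate `x i` lies in a finite `∅`-definable subset of
`(ℂ, +, ·, −, 0, 1, exp)`.
Why true: `W_x` is cut out by FINITELY many polynomials with INTEGER coefficients (Hilbert basis for the
relation ideal in `ℚ[X, Y]`, clear denominators), each an `L_exp`-term equation in `(z, exp z)`; "`z` is
ℚ-linearly independent" is ONE `∅`-formula because `ℤ = {m | ∀ t, exp t = 1 → exp (m t) = 1}` is `∅`-definable
in `ℂ_exp` (tree `kmo_definable_isInt`, `kmo_isInt_iff`, PROVED, KMOPointwiseDefinableProofs.lean) — so the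
mate set is `∅`-definable as an `n`-ary relation (`Set.Definable` on `Fin n → ℂ`), finite by hypothesis, and its
`i`-th coordinate projection (which contains `x i`, as `x` is a mate of itself) is finite and `∅`-definable
(`∃`-projection of a definable set: `Set.Definable.image_comp` / `Set.Definable₁`). Consistent with Disproof
`countableVersion_holds` (the countable version is already a theorem; finiteness is the whole point) and with
(S*)'s parameter-freeness (no parameter enters: `x` is eliminated by quantifying over the finite integer relation
basis). Readable form: `isolationFree`.
Gen-2 pointers (size S/M, ~120–250 lines; the kit LANDED on 2026-08-15/16 under the sibling crux, sorry-free and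
importable: `import Summits.Schanuel.Schanuel.Theorems.AclSubsetLogFreeCore.Negative.ExpAclField` etc., namespace
`Summit.Schanuel.Schanuel.Theorems.AclSubsetLogFreeCore.Negative`): the conclusion `∃ s, s.Finite ∧ Definable₁ ∅ … s ∧
x i ∈ s` is `x i ∈ expAcl` by `Iff.rfl` (`LogFreeCoreObjects.expAcl`, VERBATIM this shape); each locus equation
`aeval (Sum.elim z (cexp ∘ z)) P = 0` with `P ∈ MvPolynomial (Fin n ⊕ Fin n) ℤ` is `∅`-definable by
`ExpAclField.definableFun_mvPolynomial_aeval'` composed with `ExpAclDefinability.definableFun_cexp` /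
`definableFun_reindex` (the map `z ↦ Sum.elim z (cexp ∘ z)` coordinatewise) and `Set.Definable` of an equation between
definable functions; finitely many `P` suffice (relation ideal of `(x, eˣ)` in `ℚ[X ⊕ Y]` is finitely generated —
`MvPolynomial` over `ℚ` in finitely many variables is Noetherian, `IsNoetherianRing`, `Ideal.fg_of_isNoetherianRing`/
`(inferInstance : IsNoetherian …)` — clear denominators to land in `ℤ`-coefficients; evaluation is a ring hom so
generators decide the whole ideal); "`z` is ℚ-linearly independent" ⟺ `∀ m ∈ ℤⁿ, ∑ mᵢ zᵢ = 0 → m = 0` (clear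
denominators; `LinearIndependent` over `ℚ` ↔ over `ℤ` for torsion-free targets: `LinearIndependent.restrict_scalars`
/ direct `Fintype.linearIndependent_iff`) and `ℤ ⊆ ℂ` is `∅`-definable (`ExpAclDefinability.definable_mem_intSet`,
`definable₁_int`, `LogFreeCoreObjects.mem_intSet_iff`), so the mate set is `∅`-definable via `Set.Definable.preimage_comp`,
`Set.Definable.inter/.compl/image_comp` (Mathlib `Set.Definable.image_comp (f : α → β) [Finite α] [Finite β]` for the
`∃`-projections); the `i`-th coordinate projection of the finite definable mate set is
`Set.Definable.image_comp (fun _ : Fin 1 => i)`, finite as the image of a finite set, and contains `x i`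
(`self_mem_locusMates`). The sibling line kernel-arithmetic-selection registers the two halves as
`LinearIndependentDefinable` / `LocusDefinable` with glue `coord_mem_expAcl` — one worker serves both lines. -/
theorem stub_isolationFree :
    ∀ {n : ℕ} {x : Fin n → ℂ},
      (LinearIndependent ℚ x ∧
        Algebra.trdeg ℚ ↥(IntermediateField.adjoin ℚ (Set.range x ∪ Set.range (Complex.exp ∘ x))) <
          (n : Cardinal) ∧
        ∀ r < n, Literature.NumberTheory.Transcendental.SchanuelRank r) →
      Set.Finite {x' : Fin n → ℂ | LinearIndependent ℚ x' ∧
          ∀ p : MvPolynomial (Fin n ⊕ Fin n) ℚ,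
            MvPolynomial.aeval (Sum.elim x (Complex.exp ∘ x)) p = 0 →
              MvPolynomial.aeval (Sum.elim x' (Complex.exp ∘ x')) p = 0} →
      ∀ i : Fin n, ∃ s : Set ℂ, s.Finite ∧
        Set.Definable₁ (∅ : Set ℂ) Literature.ModelTheory.ExponentialFields.Language.expRing s ∧ x i ∈ s := by
  sorry

/-! ## Glue (sorry-free) -/

/-! ### Readable forms of the stubs (definitional restatements; they type-check that the inlined registered
signatures agree with the vocabulary) -/

/-- T1, readable. -/
theorem matePredim {n : ℕ} {x : Fin n → ℂ} (hx : IsFirstFailure x) {x' : Fin n → ℂ}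
    (hx' : x' ∈ locusMates x) :
    GammaField.predim (⊥ : Submodule ℚ ℂ) (Submodule.span ℚ (range x')) ≤ -1 :=
  stub_matePredim hx hx'

/-- T2, readable. -/
theorem spanGrowthStep {n : ℕ} (hrank : ∀ r < n, SchanuelRank r) {x' : Fin n → ℂ}
    (hli : LinearIndependent ℚ x')
    (hδ : GammaField.predim (⊥ : Submodule ℚ ℂ) (Submodule.span ℚ (range x')) ≤ -1)
    (S : Submodule ℚ ℂ) (hS : S.FG) (hnew : ¬ (range x' ⊆ (S : Set ℂ))) :
    GammaField.predim (⊥ : Submodule ℚ ℂ) (S ⊔ Submodule.span ℚ (range x')) ≤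
      GammaField.predim (⊥ : Submodule ℚ ℂ) S - 1 :=
  stub_spanGrowthStep hrank hli hδ S hS hnew

/-- D, readable. -/
theorem locusDefectBounded {n : ℕ} {x : Fin n → ℂ} (hx : IsFirstFailure x) :
    ∃ d : ℕ, ∀ G : Finset ℂ, (G : Set ℂ) ⊆ mateCoords x →
      -(d : ℤ) ≤ GammaField.predim (⊥ : Submodule ℚ ℂ) (Submodule.span ℚ (range x ∪ (G : Set ℂ))) :=
  stub_locusDefectBounded hx

/-- M, readable. -/
theorem finiteRankCase {n : ℕ} {x : Fin n → ℂ} (hx : IsFirstFailure x) (s : Finset ℂ)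
    (hs : ∀ x' ∈ locusMates x, range x' ⊆ (Submodule.span ℚ (s : Set ℂ) : Set ℂ)) :
    (locusMates x).Finite :=
  stub_finiteRankCase hx s hs

/-- I, readable. -/
theorem isolationFree {n : ℕ} {x : Fin n → ℂ} (hx : IsFirstFailure x) (hfin : (locusMates x).Finite)
    (i : Fin n) :
    ∃ s : Set ℂ, s.Finite ∧ Set.Definable₁ (∅ : Set ℂ) Language.expRing s ∧ x i ∈ s :=
  stub_isolationFree hx hfin i

/-! ### The dichotomy and the composition -/

/-- `x` is a locus mate of itself. -/
theorem self_mem_locusMates {n : ℕ} {x : Fin n → ℂ} (hx : IsFirstFailure x) :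
    x ∈ locusMates x :=
  ⟨hx.1, fun _ hp => hp⟩

/-- The coordinates of a mate are mate coordinates. -/
theorem range_subset_mateCoords {n : ℕ} {x x' : Fin n → ℂ} (hx' : x' ∈ locusMates x) :
    range x' ⊆ mateCoords x :=
  Set.subset_biUnion_of_mem (u := fun y : Fin n → ℂ => range y) hx'

/-- Depth `0` of the tower: `δ(span x) ≤ −1` (Stub T1 at `x' = x`). -/
theorem deepTower_zero {n : ℕ} {x : Fin n → ℂ} (hx : IsFirstFailure x) : DeepTower x 0 := by
  refine ⟨∅, by simp, ?_⟩
  simpa using matePredim hx (self_mem_locusMates hx)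

/-- The tower grows: a mate OUTSIDE `span(x ∪ G)` deepens a depth-`k` tower to depth `k + 1`
(Stub T2, fed by Stub T1). -/
theorem deepTower_succ_of_new {n : ℕ} {x : Fin n → ℂ} (hx : IsFirstFailure x) {k : ℕ}
    {G : Finset ℂ} (hG : (G : Set ℂ) ⊆ mateCoords x)
    (hGδ : GammaField.predim (⊥ : Submodule ℚ ℂ) (Submodule.span ℚ (range x ∪ (G : Set ℂ))) ≤
      -((k : ℤ) + 1))
    {x' : Fin n → ℂ} (hx' : x' ∈ locusMates x)
    (hnew : ¬ (range x' ⊆ (Submodule.span ℚ (range x ∪ (G : Set ℂ)) : Set ℂ))) :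
    DeepTower x (k + 1) := by
  classical
  refine ⟨G ∪ Finset.univ.image x', ?_, ?_⟩
  · rw [Finset.coe_union]
    refine Set.union_subset hG ?_
    rw [Finset.coe_image, Finset.coe_univ, Set.image_univ]
    exact range_subset_mateCoords hx'
  · have hS : (Submodule.span ℚ (range x ∪ (G : Set ℂ))).FG :=
      Submodule.fg_span ((Set.finite_range x).union G.finite_toSet)
    have hstep := spanGrowthStep hx.2.2 hx'.1 (matePredim hx hx') _ hS hnew
    have hspan : Submodule.span ℚ (range x ∪ ((G ∪ Finset.univ.image x' : Finset ℂ) : Set ℂ)) =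
        Submodule.span ℚ (range x ∪ (G : Set ℂ)) ⊔ Submodule.span ℚ (range x') := by
      rw [Finset.coe_union, Finset.coe_image, Finset.coe_univ, Set.image_univ, ← Set.union_assoc,
        Submodule.span_union]
    rw [hspan]
    push_cast
    linarith

/-- A tower that exists at depth `0` and not at depth `d` has a LAST depth. -/
theorem exists_last_depth {n : ℕ} {x : Fin n → ℂ} (h0 : DeepTower x 0) {d : ℕ}
    (hd : ¬ DeepTower x d) : ∃ k, DeepTower x k ∧ ¬ DeepTower x (k + 1) := by
  by_contra h
  push Not at h
  have hall : ∀ k, DeepTower x k := by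
    intro k
    induction k with
    | zero => exact h0
    | succ k ih => exact h k ih
  exact hd (hall d)

/-- At the last depth every mate is inside the tower's span: bounded ℚ-rank of the mate family. -/
theorem rank_bounded_of_last_depth {n : ℕ} {x : Fin n → ℂ} (hx : IsFirstFailure x) {k : ℕ}
    (hk : DeepTower x k) (hk' : ¬ DeepTower x (k + 1)) :
    ∃ s : Finset ℂ, ∀ x' ∈ locusMates x, range x' ⊆ (Submodule.span ℚ (s : Set ℂ) : Set ℂ) := by
  classical
  obtain ⟨G, hG, hGδ⟩ := hk
  refine ⟨Finset.univ.image x ∪ G, fun x' hx' => ?_⟩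
  have hcoe : ((Finset.univ.image x ∪ G : Finset ℂ) : Set ℂ) = range x ∪ (G : Set ℂ) := by
    rw [Finset.coe_union, Finset.coe_image, Finset.coe_univ, Set.image_univ]
  rw [hcoe]
  by_contra hnew
  exact hk' (deepTower_succ_of_new hx hG hGδ hx' hnew)

/-- **The span-growth dichotomy** (sorry-free over Stubs T1–T2 only): along the mate family of a
first-failure locus, EITHER the predimension is unbounded below (towers of every depth: branch (I),
"Schanuel fails infinitely badly inside one ℚ-locus") OR all mates lie in one finite-dimensional
ℚ-space (branch (II), the finite-rank case). -/
theorem span_growth_dichotomy {n : ℕ} {x : Fin n → ℂ} (hx : IsFirstFailure x) :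
    (∀ k, DeepTower x k) ∨
      ∃ s : Finset ℂ, ∀ x' ∈ locusMates x, range x' ⊆ (Submodule.span ℚ (s : Set ℂ) : Set ℂ) := by
  by_cases h : ∀ k, DeepTower x k
  · exact Or.inl h
  · right
    push Not at h
    obtain ⟨d, hd⟩ := h
    obtain ⟨k, hk, hk'⟩ := exists_last_depth (deepTower_zero hx) hd
    exact rank_bounded_of_last_depth hx hk hk'

/-- Branch (I) is excluded by Stub D: the mate family has bounded ℚ-rank. -/
theorem mates_rank_bounded {n : ℕ} {x : Fin n → ℂ} (hx : IsFirstFailure x) :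
    ∃ s : Finset ℂ, ∀ x' ∈ locusMates x, range x' ⊆ (Submodule.span ℚ (s : Set ℂ) : Set ℂ) := by
  obtain ⟨d, hd⟩ := locusDefectBounded hx
  have hnot : ¬ DeepTower x d := by
    rintro ⟨G, hG, hGδ⟩
    have h := hd G hG
    linarith
  obtain ⟨k, hk, hk'⟩ := exists_last_depth (deepTower_zero hx) hnot
  exact rank_bounded_of_last_depth hx hk hk'

/-- Converse bookkeeping (unconditional, sorry-free): bounded ℚ-rank of the mate family gives Stub D
with `d = |s|`, because `δ(V) = td(V) − dim V ≥ −dim V ≥ −|s|` for `V ≤ span s`. Together with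
`mates_rank_bounded` this certifies: given T1/T2, Stub D ⟺ bounded rank of the mate family. -/
theorem locusDefectBounded_of_rank_bounded {n : ℕ} {x : Fin n → ℂ} (hx : IsFirstFailure x)
    (s : Finset ℂ) (hs : ∀ x' ∈ locusMates x, range x' ⊆ (Submodule.span ℚ (s : Set ℂ) : Set ℂ)) :
    ∃ d : ℕ, ∀ G : Finset ℂ, (G : Set ℂ) ⊆ mateCoords x →
      -(d : ℤ) ≤ GammaField.predim (⊥ : Submodule ℚ ℂ) (Submodule.span ℚ (range x ∪ (G : Set ℂ))) := by
  refine ⟨s.card, fun G hG => ?_⟩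
  have hle : Submodule.span ℚ (range x ∪ (G : Set ℂ)) ≤ Submodule.span ℚ (s : Set ℂ) := by
    refine Submodule.span_le.2 (Set.union_subset (hs x (self_mem_locusMates hx)) fun c hc => ?_)
    obtain ⟨x', hx', hc'⟩ := Set.mem_iUnion₂.1 (hG hc)
    exact hs x' hx' hc'
  have h1 : GammaField.ldim (⊥ : Submodule ℚ ℂ) (Submodule.span ℚ (range x ∪ (G : Set ℂ))) ≤
      GammaField.ldim (⊥ : Submodule ℚ ℂ) (Submodule.span ℚ (s : Set ℂ)) :=
    GammaField.ldim_mono (GammaField.isFG_span_finset ⊥ s) hle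
  have h2 : GammaField.ldim (⊥ : Submodule ℚ ℂ) (Submodule.span ℚ (s : Set ℂ)) ≤ s.card :=
    GammaField.ldim_span_le_card ⊥ s
  rw [GammaField.predim_def]
  omega

/-- The CONDITIONAL BRIDGE, kernel-checked: global bounded defect (card K2) gives Stub D for free. -/
theorem locusDefectBounded_of_boundedDefectδ (hBD : BoundedDefectδ) {n : ℕ} {x : Fin n → ℂ}
    (_hx : IsFirstFailure x) :
    ∃ d : ℕ, ∀ G : Finset ℂ, (G : Set ℂ) ⊆ mateCoords x →
      -(d : ℤ) ≤ GammaField.predim (⊥ : Submodule ℚ ℂ) (Submodule.span ℚ (range x ∪ (G : Set ℂ))) := by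
  obtain ⟨d, hd⟩ := hBD
  exact ⟨d, fun G _ => hd _ (Submodule.fg_span ((Set.finite_range x).union G.finite_toSet))⟩

/-- **The composition (concludes the crux BY NAME).** A first failure `x` has a mate family of
bounded ℚ-rank (T1 + T2 + D, `mates_rank_bounded`), hence finitely many mates (M), hence every
coordinate in a finite `∅`-definable set (I). -/
theorem MinimalCounterexampleInAcl_of :
    Summit.Schanuel.Schanuel.Theses.RigidCore.MinimalCounterexampleInAcl := by
  intro n x hli htr hrank i
  have hx : IsFirstFailure x := ⟨hli, htr, hrank⟩
  obtain ⟨s, hs⟩ := mates_rank_bounded hx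
  exact isolationFree hx (finiteRankCase hx s hs) i

end Summit.Schanuel.Schanuel.Cruxes.MinimalCounterexampleInAcl.SpanGrowthDichotomy

end
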